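import Mathlib
import Summits.ValiantsHypothesis.ValiantsHypothesis.Theorems.ValuativeGCTValuativeFlipPencilWeightSplit
import Summits.ValiantsHypothesis.ValiantsHypothesis.Theorems.ValuativeGCTValuativeFlipFourRowTransfer

/-!
# `stub_fourRowPencilRank` from per-class independence off class `0` (crux `ValuativeGCT.ValuativeFlip`)

Helper file (`--supports stmt-ValiantsHypothesis-12624`) for line `four-row-count`, stub
`stub_fourRowPencilRank`.  Wall-breaker axis k10 (rank tables): the tables
(`Cruxes/ValuativeFlip/AxisK10G1PencilRankTables.md`, evidence `pencil_rank_tables_k10g1.md`) show an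
explicit potential-graded pencil — the graded block-tridiagonal chain with `2 × 2` blocks, `≈ 5n` cells,
class `0` of size `8n − 8` — whose every weight class `w ≠ 0` has full rank in the sparse regime
(`n ≤ 22`, exact).  This file turns that observation into the exact remaining obligation:

* `pws_pencilBound_of_offZero_independence` — if for all large `n` some potential-graded pencil
  (`φ t = h c − h r` on nonzero cells, weights in `ℤ`) has an invertible `4 × 4` coordinate minor, at
  most `8n` generators in class `0`, and linearly independent classes `w ≠ 0`, then the `m`-free
  certificate `H` of `fourRowPencilRank_of_pencilCertificate` holds (`4n² − 8n ≥ 2⌊6n/5⌋² + ⌊6n/5⌋ + 2`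
  for `n ≥ 10`, via `pws_card_sub_card_classZero_le_finrank`);
* `fourRowPencilRank_of_offZero_independence` — hence the registered stub `stub_fourRowPencilRank`
  VERBATIM (composition with k4's `fourRowPencilRank_of_pencilCertificate`).

So the per-side heart of the head is now: *per-class linear independence, off class `0`, of the
four-row generators of one explicit sparse pencil* (Conjecture GBT2 of the axis note).  [this crux's line
four-row-count; folklore]
-/

set_option linter.dupNamespace false

namespace Summit.ValiantsHypothesis.ValiantsHypothesis.Theorems.ValuativeFlip

open MvPolynomial Literature.NumberTheory.DiophantineGeometry Literature.Computability.AlgebraicComplexity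
open scoped BigOperators

noncomputable section

/-- The counting step: `2⌊6n/5⌋² + ⌊6n/5⌋ + 2 ≤ 4n² − 8n` for `n ≥ 10`. [folklore] -/
theorem pws_target_le (n : ℕ) (hn : 10 ≤ n) : 2 * (6 * n / 5) ^ 2 + 6 * n / 5 + 2 ≤ 4 * (n * n) - 8 * n := by
  have h1 : 5 * (6 * n / 5) ≤ 6 * n := Nat.mul_div_le (6 * n) 5
  set q := 6 * n / 5 with hq
  have h2 : 8 * n ≤ 4 * (n * n) := by nlinarith
  zify [h2]
  have h1' : (5 : ℤ) * q ≤ 6 * n := by exact_mod_cast h1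
  have hn' : (10 : ℤ) ≤ n := by exact_mod_cast hn
  nlinarith [h1', hn', sq_nonneg ((q : ℤ)), sq_nonneg ((n : ℤ))]

/-- **`H` from per-class independence off class `0`.**  If for all large `n` there is a
potential-graded four-variable pencil (`φ t = h c − h r` on its nonzero cells, `ℤ`-valued potential)
with an invertible `4 × 4` coordinate minor, at most `8n` generators `(t, i, j)` in class
`φ t + (h i − h j) = 0`, and every other class linearly independent, then the `m`-free certificate `H` of
`fourRowPencilRank_of_pencilCertificate` holds. [this crux's line four-row-count; folklore] -/
theorem pws_pencilBound_of_offZero_independence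
    (hyp : ∃ n₀ : ℕ, ∀ n ≥ n₀, ∃ (M : Fin n × Fin n → Fin 4 → ℂ) (φ : Fin 4 → ℤ) (h : Fin n → ℤ)
      (c : Fin 4 → Fin n × Fin n),
      (∀ r c' t, M (r, c') t ≠ 0 → φ t = h c' - h r) ∧
      IsUnit (Matrix.of fun t t' : Fin 4 => M (c t') t) ∧
      (Finset.univ.filter fun tc : Fin 4 × (Fin n × Fin n) => φ tc.1 + (h tc.2.1 - h tc.2.2) = 0).card
        ≤ 8 * n ∧
      ∀ w : ℤ, w ≠ 0 → LinearIndependent ℂ fun tc : {tc : Fin 4 × (Fin n × Fin n) //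
          φ tc.1 + (h tc.2.1 - h tc.2.2) = w} =>
        (X tc.1.1 : MvPolynomial (Fin 4) ℂ) *
          aeval (fun rc : Fin n × Fin n => ∑ s : Fin 4, M rc s • (X s : MvPolynomial (Fin 4) ℂ))
            (pderiv tc.1.2 (perPoly (Fin n) ℂ))) :
    ∃ n₀ : ℕ, ∀ n ≥ n₀, ∃ (M : Fin n × Fin n → Fin 4 → ℂ) (c : Fin 4 → Fin n × Fin n),
      IsUnit (Matrix.of fun t t' : Fin 4 => M (c t') t) ∧
      2 * (6 * n / 5) ^ 2 + 6 * n / 5 + 2 ≤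
        Module.finrank ℂ ↥(Submodule.span ℂ (Set.range fun tc : Fin 4 × (Fin n × Fin n) =>
          (X tc.1 : MvPolynomial (Fin 4) ℂ) *
            aeval (fun ij : Fin n × Fin n => ∑ t : Fin 4, M ij t • (X t : MvPolynomial (Fin 4) ℂ))
              (pderiv tc.2 (perPoly (Fin n) ℂ)))) := by
  classical
  obtain ⟨n₀, hn₀⟩ := hyp
  refine ⟨max n₀ 10, fun n hn => ?_⟩
  obtain ⟨M, φ, h, c, hM, hc, hcard, hind⟩ := hn₀ n (le_of_max_le_left hn)
  refine ⟨M, c, hc, ?_⟩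
  have h10 : 10 ≤ n := le_of_max_le_right hn
  have hrank := pws_card_sub_card_classZero_le_finrank (K := ℂ) φ h M hM hind
  have hcardall : Fintype.card (Fin 4 × (Fin n × Fin n)) = 4 * (n * n) := by
    simp [Fintype.card_prod, Fintype.card_fin]
  rw [hcardall] at hrank
  calc 2 * (6 * n / 5) ^ 2 + 6 * n / 5 + 2 ≤ 4 * (n * n) - 8 * n := pws_target_le n h10
    _ ≤ 4 * (n * n) - (Finset.univ.filter fun tc : Fin 4 × (Fin n × Fin n) =>
          φ tc.1 + (h tc.2.1 - h tc.2.2) = 0).card := Nat.sub_le_sub_left hcard _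
    _ ≤ _ := hrank

/-- **The registered stub `stub_fourRowPencilRank` from per-class independence off class `0`**
(conclusion VERBATIM the stub; composition of `pws_pencilBound_of_offZero_independence` with k4's
`fourRowPencilRank_of_pencilCertificate`).  What remains of the per-side heart of line
`four-row-count` is the hypothesis: for one explicit sparse potential-graded pencil per large `n`
(the graded block-tridiagonal chain of the rank tables has class `0` of size `8n − 8` and an invertible
minor on the cells `(0,0), (1,1), (0,2), (2,0)`), linear independence of every class `w ≠ 0`.
[this crux's line four-row-count; folklore] -/
theorem fourRowPencilRank_of_offZero_independence
    (hyp : ∃ n₀ : ℕ, ∀ n ≥ n₀, ∃ (M : Fin n × Fin n → Fin 4 → ℂ) (φ : Fin 4 → ℤ) (h : Fin n → ℤ)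
      (c : Fin 4 → Fin n × Fin n),
      (∀ r c' t, M (r, c') t ≠ 0 → φ t = h c' - h r) ∧
      IsUnit (Matrix.of fun t t' : Fin 4 => M (c t') t) ∧
      (Finset.univ.filter fun tc : Fin 4 × (Fin n × Fin n) => φ tc.1 + (h tc.2.1 - h tc.2.2) = 0).card
        ≤ 8 * n ∧
      ∀ w : ℤ, w ≠ 0 → LinearIndependent ℂ fun tc : {tc : Fin 4 × (Fin n × Fin n) //
          φ tc.1 + (h tc.2.1 - h tc.2.2) = w} =>
        (X tc.1.1 : MvPolynomial (Fin 4) ℂ) *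
          aeval (fun rc : Fin n × Fin n => ∑ s : Fin 4, M rc s • (X s : MvPolynomial (Fin 4) ℂ))
            (pderiv tc.1.2 (perPoly (Fin n) ℂ))) :
    ∃ n₀ : ℕ, ∀ n ≥ n₀, ∀ (m : ℕ) [NeZero m], n ≤ m → 5 * m ≤ 6 * n →
      ∃ g : GL (MatIdx m) ℂ, 2 * m ^ 2 + m + 2 ≤ Module.finrank ℂ ↥(Submodule.span ℂ (Set.range fun ab : {a : MatIdx m // m * m ≤ (((matIdxEquiv m).symm a : Fin (m * m)) : ℕ) + 4} × MatIdx m => (MvPolynomial.X ab.1.1 : MvPolynomial (MatIdx m) ℂ) * MvPolynomial.aeval (fun i : MatIdx m => if m * m ≤ (((matIdxEquiv m).symm i : Fin (m * m)) : ℕ) + 4 then (MvPolynomial.X i : MvPolynomial (MatIdx m) ℂ) else 0) (MvPolynomial.pderiv ab.2 (linSubst (MatIdx m) ℂ ((g : GL (MatIdx m) ℂ) : Matrix (MatIdx m) (MatIdx m) ℂ) (paddedPerFormLex ℂ n m))))) :=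
  fourRowPencilRank_of_pencilCertificate (pws_pencilBound_of_offZero_independence hyp)

/-! ## The explicit pencil of the rank tables: graded block-tridiagonal chain, `2 × 2` blocks -/

/-- **The graded block-tridiagonal pencil `GBT(2)` of the rank tables** (blocks `{2s, 2s+1}`; diagonal
cells `y₀ + u_r y₁`, super-block cells `B_{rc} y₃`, sub-block cells `C_{rc} y₂`, every other cell `0`)
is potential-graded for `φ = (0, 0, −1, 1)` and the block index `h r = ⌊r/2⌋`. [this crux's axis note
AxisK10G1PencilRankTables.md; folklore] -/
theorem pws_gbt2_potential {n : ℕ} (u : Fin n → ℂ) (B C : Fin n × Fin n → ℂ) (r c : Fin n) (t : Fin 4)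
    (hne : (fun (rc : Fin n × Fin n) (t : Fin 4) =>
      (if rc.1 = rc.2 then (if t = 0 then (1 : ℂ) else if t = 1 then u rc.1 else 0)
        else if (rc.2 : ℕ) / 2 = (rc.1 : ℕ) / 2 + 1 then (if t = 3 then B rc else 0)
        else if (rc.1 : ℕ) / 2 = (rc.2 : ℕ) / 2 + 1 then (if t = 2 then C rc else 0) else 0)) (r, c) t ≠ 0) :
    (![0, 0, -1, 1] : Fin 4 → ℤ) t = (((c : ℕ) / 2 : ℕ) : ℤ) - (((r : ℕ) / 2 : ℕ) : ℤ) := by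
  simp only [ne_eq] at hne
  by_cases hrc : r = c
  · subst hrc
    simp only [if_true] at hne
    by_cases ht0 : t = 0
    · subst ht0; simp
    · by_cases ht1 : t = 1
      · subst ht1; simp
      · simp [ht0, ht1] at hne
  · rw [if_neg hrc] at hne
    by_cases hsup : (c : ℕ) / 2 = (r : ℕ) / 2 + 1
    · rw [if_pos hsup] at hne
      by_cases ht3 : t = 3
      · subst ht3; simp [hsup]
      · simp [ht3] at hne
    · rw [if_neg hsup] at hne
      by_cases hsub : (r : ℕ) / 2 = (c : ℕ) / 2 + 1
      · rw [if_pos hsub] at hne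
        by_cases ht2 : t = 2
        · subst ht2; simp [hsub]
        · simp [ht2] at hne
      · simp [hsub] at hne

/-- Class `0` of a block grading with blocks of size `≤ 2` has at most `8n` members: on class `0` the
map `(t, i, j) ↦ (t, i, j mod 2)` is injective (the block of `j` is determined by `t` and the block of
`i`). [folklore] -/
theorem pws_card_classZero_blk_le (n : ℕ) :
    (Finset.univ.filter fun tc : Fin 4 × (Fin n × Fin n) =>
      (![0, 0, -1, 1] : Fin 4 → ℤ) tc.1 + ((((tc.2.1 : ℕ) / 2 : ℕ) : ℤ) - (((tc.2.2 : ℕ) / 2 : ℕ) : ℤ)) = 0).card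
      ≤ 8 * n := by
  classical
  set S := Finset.univ.filter fun tc : Fin 4 × (Fin n × Fin n) =>
      (![0, 0, -1, 1] : Fin 4 → ℤ) tc.1 + ((((tc.2.1 : ℕ) / 2 : ℕ) : ℤ) - (((tc.2.2 : ℕ) / 2 : ℕ) : ℤ)) = 0
    with hS
  let f : Fin 4 × (Fin n × Fin n) → Fin 4 × Fin n × Bool := fun tc => (tc.1, tc.2.1, decide ((tc.2.2 : ℕ) % 2 = 0))
  have hinj : Set.InjOn f ↑S := by
    rintro ⟨t, i, j⟩ htc ⟨t', i', j'⟩ htc' hff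
    simp only [f, Prod.mk.injEq, decide_eq_decide] at hff
    obtain ⟨rfl, rfl, hpar⟩ := hff
    simp only [hS, Finset.coe_filter, Finset.mem_univ, true_and, Set.mem_setOf_eq] at htc htc'
    have hblk : ((j : ℕ) / 2 : ℤ) = ((j' : ℕ) / 2 : ℤ) := by
      push_cast at htc htc' ⊢
      linarith
    have hblk' : (j : ℕ) / 2 = (j' : ℕ) / 2 := by exact_mod_cast hblk
    have hmod : (j : ℕ) % 2 = (j' : ℕ) % 2 := by
      rcases Nat.mod_two_eq_zero_or_one (j : ℕ) with h0 | h1 <;>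
        rcases Nat.mod_two_eq_zero_or_one (j' : ℕ) with h0' | h1' <;> simp_all
    have hjj : (j : ℕ) = (j' : ℕ) := by
      rw [← Nat.div_add_mod (j : ℕ) 2, ← Nat.div_add_mod (j' : ℕ) 2, hblk', hmod]
    simp [Fin.ext_iff, hjj]
  calc S.card = (S.image f).card := (Finset.card_image_of_injOn hinj).symm
    _ ≤ (Finset.univ : Finset (Fin 4 × Fin n × Bool)).card := Finset.card_le_card (Finset.subset_univ _)
    _ = 8 * n := by simp [Finset.card_univ, Fintype.card_prod, Fintype.card_fin, Fintype.card_bool]; ring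

/-- The coordinate minor of the explicit pencil on the cells `(0,0), (1,1), (0,2), (2,0)` is invertible as
soon as `u 0 ≠ u 1`, `B (0,2) ≠ 0`, `C (2,0) ≠ 0` (determinant `(u 1 − u 0)·B(0,2)·C(2,0)` up to sign).
[folklore] -/
theorem pws_gbt2_isUnit_minor {n : ℕ} (u : Fin n → ℂ) (B C : Fin n × Fin n → ℂ) (i₀ i₁ i₂ : Fin n)
    (h₀ : (i₀ : ℕ) = 0) (h₁ : (i₁ : ℕ) = 1) (h₂ : (i₂ : ℕ) = 2) (hu : u i₀ ≠ u i₁) (hB : B (i₀, i₂) ≠ 0)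
    (hC : C (i₂, i₀) ≠ 0) :
    IsUnit (Matrix.of fun t t' : Fin 4 =>
      (fun (rc : Fin n × Fin n) (t : Fin 4) =>
        (if rc.1 = rc.2 then (if t = 0 then (1 : ℂ) else if t = 1 then u rc.1 else 0)
          else if (rc.2 : ℕ) / 2 = (rc.1 : ℕ) / 2 + 1 then (if t = 3 then B rc else 0)
          else if (rc.1 : ℕ) / 2 = (rc.2 : ℕ) / 2 + 1 then (if t = 2 then C rc else 0) else 0))
        ((![(i₀, i₀), (i₁, i₁), (i₀, i₂), (i₂, i₀)] : Fin 4 → Fin n × Fin n) t') t) := by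
  have h01 : i₀ ≠ i₁ := by intro h; apply_fun (fun x : Fin n => (x : ℕ)) at h; omega
  have h02 : i₀ ≠ i₂ := by intro h; apply_fun (fun x : Fin n => (x : ℕ)) at h; omega
  have h20 : i₂ ≠ i₀ := fun h => h02 h.symm
  have hsup : (i₂ : ℕ) / 2 = (i₀ : ℕ) / 2 + 1 := by rw [h₀, h₂]
  have hnsup : ¬ ((i₀ : ℕ) / 2 = (i₂ : ℕ) / 2 + 1) := by rw [h₀, h₂]; omega
  have hA : (Matrix.of fun t t' : Fin 4 =>
      (fun (rc : Fin n × Fin n) (t : Fin 4) =>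
        (if rc.1 = rc.2 then (if t = 0 then (1 : ℂ) else if t = 1 then u rc.1 else 0)
          else if (rc.2 : ℕ) / 2 = (rc.1 : ℕ) / 2 + 1 then (if t = 3 then B rc else 0)
          else if (rc.1 : ℕ) / 2 = (rc.2 : ℕ) / 2 + 1 then (if t = 2 then C rc else 0) else 0))
        ((![(i₀, i₀), (i₁, i₁), (i₀, i₂), (i₂, i₀)] : Fin 4 → Fin n × Fin n) t') t) =
      !![1, 1, 0, 0; u i₀, u i₁, 0, 0; 0, 0, 0, C (i₂, i₀); 0, 0, B (i₀, i₂), 0] := by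
    ext t t'
    fin_cases t <;> fin_cases t' <;> simp [h02, h20, h₀, h₂]
  rw [hA, Matrix.isUnit_iff_isUnit_det, isUnit_iff_ne_zero]
  have hdet : Matrix.det !![1, 1, 0, 0; u i₀, u i₁, 0, 0; 0, 0, 0, C (i₂, i₀); 0, 0, B (i₀, i₂), 0] =
      -((u i₁ - u i₀) * (B (i₀, i₂) * C (i₂, i₀))) := by
    rw [Matrix.det_succ_row_zero]
    simp [Fin.sum_univ_succ, Matrix.det_fin_three, Matrix.submatrix_apply, Fin.succAbove]
    ring
  rw [hdet, neg_ne_zero]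
  exact mul_ne_zero (sub_ne_zero.2 (Ne.symm hu)) (mul_ne_zero hB hC)

/-- **`stub_fourRowPencilRank` from Conjecture GBT2** (per-class linear independence off class `0` of the
four-row generators of the explicit graded block-tridiagonal pencil; conclusion VERBATIM the stub).  The
hypothesis is exactly what the rank tables verify for `n ≤ 24` in every sparse class: for all large `n`,
parameters `u` (pairwise distinct suffices numerically, `u 0 ≠ u 1` is all the minor needs), `B`, `C`
with `B(0,2), C(2,0) ≠ 0`, such that for every weight `w ≠ 0` the generators
`X_t · (∂_{(i,j)} per_n)(M·X)` with `φ t + ⌊i/2⌋ − ⌊j/2⌋ = w` are linearly independent.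
[this crux's axis note AxisK10G1PencilRankTables.md; folklore] -/
theorem fourRowPencilRank_of_gbt2_classIndependence
    (hyp : ∃ n₀ : ℕ, ∀ n ≥ n₀, ∃ (u : Fin n → ℂ) (B C : Fin n × Fin n → ℂ) (i₀ i₁ i₂ : Fin n),
      (i₀ : ℕ) = 0 ∧ (i₁ : ℕ) = 1 ∧ (i₂ : ℕ) = 2 ∧ u i₀ ≠ u i₁ ∧ B (i₀, i₂) ≠ 0 ∧ C (i₂, i₀) ≠ 0 ∧
      ∀ w : ℤ, w ≠ 0 → LinearIndependent ℂ fun tc : {tc : Fin 4 × (Fin n × Fin n) //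
          (![0, 0, -1, 1] : Fin 4 → ℤ) tc.1 +
            ((((tc.2.1 : ℕ) / 2 : ℕ) : ℤ) - (((tc.2.2 : ℕ) / 2 : ℕ) : ℤ)) = w} =>
        (X tc.1.1 : MvPolynomial (Fin 4) ℂ) *
          aeval (fun rc : Fin n × Fin n => ∑ s : Fin 4,
            (fun (rc : Fin n × Fin n) (t : Fin 4) =>
              (if rc.1 = rc.2 then (if t = 0 then (1 : ℂ) else if t = 1 then u rc.1 else 0)
                else if (rc.2 : ℕ) / 2 = (rc.1 : ℕ) / 2 + 1 then (if t = 3 then B rc else 0)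
                else if (rc.1 : ℕ) / 2 = (rc.2 : ℕ) / 2 + 1 then (if t = 2 then C rc else 0) else 0))
              rc s • (X s : MvPolynomial (Fin 4) ℂ))
            (pderiv tc.1.2 (perPoly (Fin n) ℂ))) :
    ∃ n₀ : ℕ, ∀ n ≥ n₀, ∀ (m : ℕ) [NeZero m], n ≤ m → 5 * m ≤ 6 * n →
      ∃ g : GL (MatIdx m) ℂ, 2 * m ^ 2 + m + 2 ≤ Module.finrank ℂ ↥(Submodule.span ℂ (Set.range fun ab : {a : MatIdx m // m * m ≤ (((matIdxEquiv m).symm a : Fin (m * m)) : ℕ) + 4} × MatIdx m => (MvPolynomial.X ab.1.1 : MvPolynomial (MatIdx m) ℂ) * MvPolynomial.aeval (fun i : MatIdx m => if m * m ≤ (((matIdxEquiv m).symm i : Fin (m * m)) : ℕ) + 4 then (MvPolynomial.X i : MvPolynomial (MatIdx m) ℂ) else 0) (MvPolynomial.pderiv ab.2 (linSubst (MatIdx m) ℂ ((g : GL (MatIdx m) ℂ) : Matrix (MatIdx m) (MatIdx m) ℂ) (paddedPerFormLex ℂ n m))))) := by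
  refine fourRowPencilRank_of_offZero_independence ?_
  obtain ⟨n₀, hn₀⟩ := hyp
  refine ⟨n₀, fun n hn => ?_⟩
  obtain ⟨u, B, C, i₀, i₁, i₂, h₀, h₁, h₂, hu, hB, hC, hind⟩ := hn₀ n hn
  refine ⟨_, (![0, 0, -1, 1] : Fin 4 → ℤ), fun r : Fin n => (((r : ℕ) / 2 : ℕ) : ℤ),
    (![(i₀, i₀), (i₁, i₁), (i₀, i₂), (i₂, i₀)] : Fin 4 → Fin n × Fin n),
    fun r c t hne => pws_gbt2_potential u B C r c t hne,
    pws_gbt2_isUnit_minor u B C i₀ i₁ i₂ h₀ h₁ h₂ hu hB hC,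
    pws_card_classZero_blk_le n, hind⟩

end

end Summit.ValiantsHypothesis.ValiantsHypothesis.Theorems.ValuativeFlip
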